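import Mathlib
import HarnessLib
import Literature.Probability.Percolation.TwoPointFunction
import Literature.Probability.LatticeModels.CorrelationDecay
import Literature.Barriers.CriticalPhenomena.KozmaNachmiasLemma31
import Literature.Probability.Percolation.SiteConnectionTools
import Literature.Probability.Percolation.LatticeSymmetry
import Literature.Probability.Percolation.ConnectivityContinuityProofs
import Literature.Probability.Percolation.CriticalContinuityProofs
import Literature.Probability.Percolation.TreeGraphBound
import Literature.Barriers.CriticalPhenomena.LaceExpansionXSpaceLemma16

/-!
# `stub_massVanishes` of line `registered` (crux `BlockCrossover`, stmt-CriticalPhenomena-11550):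
# the axial mass of bond percolation on `ℤ³` tends to `0` as `p ↑ p_c`

Registered stub of the lead's skeleton `Cruxes/BlockCrossover/Lines/birth.lean`, proved from tree
facts only. Claim: for every `ε > 0` there is `p₀ < p_c(ℤ³)` such that for every `p ∈ (p₀, p_c)`
any `m` with `HasInvCorrLength (τ_p(0, ·)) m` (i.e. `-log τ_p(0, n e₀)/n → m`) satisfies `m < ε`
(Grimmett 1999, Thm. (6.14): `φ(p) → φ(p_c) = 0` as `p ↑ p_c`; only this upper bound is needed, and
it is obtained here without the continuity of `φ`). Write `a_p(n) = τ_p(0, n e₀)`.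

* (A) `rate_le_quotient`: Harris–FKG and translation invariance give `a_p(j + n) ≥ a_p(j) a_p(n)`,
  hence `a_p(kn) ≥ a_p(n)^k`, and along the subsequence `k ↦ kn` one reads off
  `m ≤ -log a_p(n) / n` for every `n ≥ 1` (`p > 0`, so `a_p > 0`).
* (B) `exists_sphere_tau_ge`: Kozma–Nachmias 2011 Lemma 3.1 at `p_c`
  (`sum_sphere_real_openConnIn_ge`: `Σ_{z ∈ ∂Λ_r} P_{p_c}(0 ↔ z in Λ_r) ≥ 1/6`), pigeonhole over
  `|∂Λ_r| ≤ |Λ_r| = (2r+1)³` and `{0 ↔ z in Λ_r} ⊆ {0 ↔ z}` give `z ∈ ∂Λ_r` with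
  `τ_{p_c}(0, z) ≥ 1/(6 (2r+1)³)`.
* (C) `sq_le_tau_axis`: `z` has a coordinate `i` with `|z_i| = r`; with `z' = -ρ_i z` (`ρ_i` the
  reflection in the `i`-th coordinate hyperplane) `z + z' = 2 z_i e_i`, so by Harris, translation
  and symmetry invariance `τ_p(0, 2r e₀) = τ_p(0, 2 z_i e_i) ≥ τ_p(0, z) τ_p(0, z') = τ_p(0, z)²`.
* (D) lower semicontinuity of `p ↦ τ_p(0, 2r e₀)` at `p_c` (`lowerSemicontinuous_real_openConn`)
  gives `p₀ < p_c` with `a_p(2r) > a_{p_c}(2r)/2 ≥ 1/(72 (2r+1)⁶)` on `(p₀, p_c]`; with (A) at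
  `n = 2r`, `m < log (72 (2r+1)⁶) / (2r)`, which is `< ε` once `r` is large (`log r / r → 0`,
  `exists_rate_bound_lt`).
-/

noncomputable section

namespace Summit.CriticalPhenomena.PercolationContinuityZ3.Theorems.BlockCrossover

open MeasureTheory Filter Topology
open Literature.Probability.Percolation Literature.Probability.LatticeModels

namespace StubMassVanishes

/-! ### Two-point function tools: super-multiplicativity, symmetry -/

/-- Super-multiplicativity seen from the origin: `τ_p(0, x) τ_p(0, y) ≤ τ_p(0, x + y)`
(Harris `τ(0,x) τ(x,x+y) ≤ τ(0,x+y)`, the tree's `tau_mul_tau_le_tau`, and translation invariance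
`τ_p(x, x + y) = τ_p(0, y)`). -/
theorem tau_zero_mul_le {d : ℕ} (p : unitInterval) (x y : Site d) :
    tau d p 0 x * tau d p 0 y ≤ tau d p 0 (x + y) := by
  have h := Literature.Barriers.CriticalPhenomena.tau_mul_tau_le_tau p 0 x (x + y)
  rwa [tau_eq_tau_zero_sub p x (x + y), add_sub_cancel_left] at h

/-- Automorphism invariance of the two-point function: `τ_p(γ x, γ y) = τ_p(x, y)` for
`γ ∈ Aut(ℤ^d)` (the relabelled configuration has the same law and an isomorphic open graph). -/
theorem tau_iso {d : ℕ} (γ : zdGraph d ≃g zdGraph d) (p : unitInterval) (x y : Site d) :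
    tau d p (γ x) (γ y) = tau d p x y := by
  simp only [tau_def]
  rw [← bondPercolation_real_preimage_relabel_iso γ p (openConn (γ x) (γ y))]
  congr 1
  ext ω
  simp only [Set.mem_preimage, openConn, Set.mem_setOf_eq]
  let ψ : openGraph ω ≃g openGraph (BondConfig.relabel (sym2Equiv γ.toEquiv) ω) :=
    { toEquiv := γ.toEquiv
      map_rel_iff' := fun {a b} => openGraph_relabel_adj_iff γ.toEquiv ω a b }
  exact ψ.reachable_iff

/-- Central symmetry: `τ_p(0, -x) = τ_p(0, x)`. -/
theorem tau_zero_neg {d : ℕ} (p : unitInterval) (x : Site d) :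
    tau d p 0 (-x) = tau d p 0 x := by
  rw [tau_comm p 0 x, tau_eq_tau_zero_sub p x 0, zero_sub]

/-- Moving an axis point to the first axis by a coordinate swap: `τ_p(0, c e_i) = τ_p(0, c e₀)`. -/
theorem tau_single_eq (p : unitInterval) (i : Fin 3) (c : ℤ) :
    tau 3 p 0 (Pi.single i c) = tau 3 p 0 (Pi.single 0 c) := by
  have h := tau_iso (zdSignedPermIso (Equiv.swap i 0) 1) p 0 (Pi.single i c)
  have h0 : (zdSignedPermIso (Equiv.swap i 0) 1) (0 : Site 3) = 0 := by simp
  have h1 : (zdSignedPermIso (Equiv.swap i 0) 1) (Pi.single i c : Site 3) = Pi.single 0 c := by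
    funext j
    rw [zdSignedPermIso_apply, Site.signedPerm_apply, Equiv.symm_swap]
    simp only [Pi.one_apply, Units.val_one, one_mul]
    by_cases hj0 : j = 0
    · subst hj0
      rw [Equiv.swap_apply_right, Pi.single_eq_same, Pi.single_eq_same]
    · by_cases hji : j = i
      · subst hji
        rw [Equiv.swap_apply_left, Pi.single_eq_of_ne (Ne.symm hj0), Pi.single_eq_of_ne hj0]
      · rw [Equiv.swap_apply_of_ne_of_ne hji hj0, Pi.single_eq_of_ne hji, Pi.single_eq_of_ne hj0]
  rw [h0, h1] at h
  exact h.symm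

/-- `c • e_i = (0, …, c, …, 0)`: an integer multiple of a unit vector is a single-coordinate vector. -/
theorem zsmul_single_eq {d : ℕ} (i : Fin d) (c : ℤ) :
    (c • Pi.single i (1 : ℤ) : Site d) = Pi.single i c := by
  funext j
  by_cases h : j = i
  · subst h; simp
  · simp [Pi.single_eq_of_ne h]

/-! ### (A) The rate is below every finite quotient -/

/-- **(A)** If `-log τ_p(0, n e₀)/n → m` and `p > 0`, then `m ≤ -log τ_p(0, n e₀) / n` for every
`n ≥ 1`: by super-multiplicativity `τ_p(0, kn e₀) ≥ τ_p(0, n e₀)^k`, so along the subsequence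
`k ↦ kn` the quotients are bounded by the quotient at `n`, and so is their limit `m`. -/
theorem rate_le_quotient {p : unitInterval} (hp : 0 < (p : ℝ)) {m : ℝ}
    (hm : HasInvCorrLength (tau 3 p 0) m) {n : ℕ} (hn : 1 ≤ n) :
    m ≤ -Real.log (tau 3 p 0 ((n : ℤ) • Pi.single (0 : Fin 3) (1 : ℤ))) / n := by
  set e : Site 3 := Pi.single (0 : Fin 3) (1 : ℤ) with he
  set a : ℕ → ℝ := fun k => tau 3 p 0 ((k : ℤ) • e) with ha
  have hpos : ∀ k, 0 < a k := fun k => tau_pos zdGraph_preconnected_holds p hp _ _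
  have hadd : ∀ j k : ℕ, a j * a k ≤ a (j + k) := fun j k => by
    have h := tau_zero_mul_le p ((j : ℤ) • e) ((k : ℤ) • e)
    rw [← add_smul, ← Nat.cast_add] at h
    exact h
  have hpow : ∀ k : ℕ, a n ^ k ≤ a (k * n) := by
    intro k
    induction k with
    | zero => simp [ha]
    | succ k ih =>
      calc a n ^ (k + 1) = a n ^ k * a n := pow_succ _ _
        _ ≤ a (k * n) * a n := mul_le_mul_of_nonneg_right ih (hpos n).le
        _ ≤ a (k * n + n) := hadd _ _
        _ = a ((k + 1) * n) := by rw [Nat.succ_mul]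
  have hbound : ∀ k : ℕ, 1 ≤ k →
      -Real.log (a (k * n)) / ((k * n : ℕ) : ℝ) ≤ -Real.log (a n) / n := by
    intro k hk
    have hk0 : (0 : ℝ) < k := by exact_mod_cast hk
    have hn0 : (0 : ℝ) < n := by exact_mod_cast hn
    have hlog : (k : ℝ) * Real.log (a n) ≤ Real.log (a (k * n)) := by
      rw [← Real.log_pow]
      exact Real.log_le_log (pow_pos (hpos n) k) (hpow k)
    rw [Nat.cast_mul, div_le_div_iff₀ (by positivity) hn0]
    have := mul_le_mul_of_nonneg_right hlog hn0.le
    nlinarith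
  have hsub : Tendsto (fun k : ℕ => k * n) atTop atTop :=
    tendsto_atTop_mono (fun k => Nat.le_mul_of_pos_right k hn) tendsto_id
  have hm' : Tendsto (fun N : ℕ => -Real.log |a N| / (N : ℝ)) atTop (𝓝 m) := hm
  have hlim := hm'.comp hsub
  refine le_of_tendsto hlim (eventually_atTop.2 ⟨1, fun k hk => ?_⟩)
  rw [Function.comp_apply, abs_of_pos (hpos _)]
  exact hbound k hk

/-! ### (B) A polynomially large connection on the sphere at `p_c` -/

/-- **(B)** At `p_c` some point `z` of the sphere `∂Λ_r` of `ℤ³` has `τ_{p_c}(0, z) ≥ 1/(6 (2r+1)³)`: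
Kozma–Nachmias Lemma 3.1 (`Σ_{z ∈ ∂Λ_r} P_{p_c}(0 ↔ z in Λ_r) ≥ 1/6`), pigeonhole over
`|∂Λ_r| ≤ |Λ_r| = (2r+1)³`, and `{0 ↔ z in Λ_r} ⊆ {0 ↔ z}`. -/
theorem exists_sphere_tau_ge (r : ℕ) :
    ∃ z ∈ sphere 3 r, 1 / (6 * (2 * (r : ℝ) + 1) ^ 3) ≤ tau 3 (criticalProbI 3) 0 z := by
  set g : Site 3 → ℝ := fun z =>
    (bondPercolation (zdGraph 3) (criticalProbI 3)).real (openConnIn (↑(box 3 r)) 0 z) with hg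
  have hsum : (1 : ℝ) / 6 ≤ ∑ z ∈ sphere 3 r, g z :=
    calc (1 : ℝ) / 6 = 1 / (2 * ((3 : ℕ) : ℝ)) := by norm_num
      _ ≤ _ := Literature.Barriers.CriticalPhenomena.sum_sphere_real_openConnIn_ge (d := 3)
          (by norm_num) (criticalProbI 3) (le_of_eq (coe_criticalProbI 3).symm) r
  have hne : (sphere 3 r).Nonempty := by
    rw [Finset.nonempty_iff_ne_empty]
    intro h
    rw [h, Finset.sum_empty] at hsum
    norm_num at hsum
  have hcpos : (0 : ℝ) < (sphere 3 r).card := by exact_mod_cast hne.card_pos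
  have hcard : ((sphere 3 r).card : ℝ) ≤ (2 * (r : ℝ) + 1) ^ 3 := by
    have h1 : (sphere 3 r).card ≤ (box 3 r).card := Finset.card_le_card (sphere_subset_box 3 r)
    rw [card_box] at h1
    exact_mod_cast h1
  obtain ⟨z, hz, hle⟩ := Finset.exists_le_of_sum_le hne
    (f := fun _ => (∑ w ∈ sphere 3 r, g w) / (sphere 3 r).card) (g := g)
    (by rw [Finset.sum_const, nsmul_eq_mul, mul_div_cancel₀ _ hcpos.ne'])
  refine ⟨z, hz, ?_⟩
  calc 1 / (6 * (2 * (r : ℝ) + 1) ^ 3) ≤ ((1 : ℝ) / 6) / (sphere 3 r).card := by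
        rw [div_div, one_div_le_one_div (by positivity) (by positivity)]
        linarith
    _ ≤ (∑ w ∈ sphere 3 r, g w) / (sphere 3 r).card := by gcongr
    _ ≤ g z := hle
    _ ≤ tau 3 (criticalProbI 3) 0 z := by
        rw [tau_def]
        exact measureReal_mono (openConnIn_subset_openConn _ 0 z)

/-! ### (C) Doubling onto the axis -/

/-- **(C)** If `z ∈ ∂Λ_r` then `τ_p(0, 2r e₀) ≥ τ_p(0, z)²`. With `i` a coordinate where `|z_i| = r`
and `z' = -ρ_i z` (`ρ_i = reflectIso i`), `z + z' = 2 z_i e_i` and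
`τ_p(0, z + z') ≥ τ_p(0, z) τ_p(0, z') = τ_p(0, z)²`; finally `2 z_i e_i = ± 2r e_i` is carried
to `2r e₀` by a coordinate swap and the central symmetry. -/
theorem sq_le_tau_axis (p : unitInterval) {r : ℕ} {z : Site 3} (hz : z ∈ sphere 3 r) :
    tau 3 p 0 z ^ 2 ≤ tau 3 p 0 (((2 * r : ℕ) : ℤ) • Pi.single (0 : Fin 3) (1 : ℤ)) := by
  rw [mem_sphere] at hz
  obtain ⟨i, hi⟩ := Site.exists_natAbs_eq_supNorm Finset.univ_nonempty z
  rw [hz] at hi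
  set z' : Site 3 := -(reflectIso i z) with hz'
  have hzz' : z + z' = Pi.single i (2 * z i) := by
    funext j
    by_cases h : j = i
    · subst h
      simp only [hz', Pi.add_apply, Pi.neg_apply, reflectIso_apply_same, Pi.single_eq_same]
      ring
    · simp only [hz', Pi.add_apply, Pi.neg_apply, reflectIso_apply_of_ne h, Pi.single_eq_of_ne h]
      ring
  have hτz' : tau 3 p 0 z' = tau 3 p 0 z := by
    rw [hz', tau_zero_neg]
    have h := tau_iso (reflectIso i) p 0 z
    rwa [show (reflectIso i) (0 : Site 3) = 0 from by simp] at h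
  have hmain : tau 3 p 0 z ^ 2 ≤ tau 3 p 0 (Pi.single i (2 * z i)) :=
    calc tau 3 p 0 z ^ 2 = tau 3 p 0 z * tau 3 p 0 z' := by rw [sq, hτz']
      _ ≤ tau 3 p 0 (z + z') := tau_zero_mul_le p z z'
      _ = tau 3 p 0 (Pi.single i (2 * z i)) := by rw [hzz']
  have hkey : tau 3 p 0 (Pi.single (0 : Fin 3) (2 * z i)) =
      tau 3 p 0 (Pi.single (0 : Fin 3) (((2 * r : ℕ) : ℤ))) := by
    rcases Int.natAbs_eq (z i) with h | h <;> rw [hi] at h <;> rw [h]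
    · push_cast; rfl
    · rw [show (2 : ℤ) * -(r : ℤ) = -(((2 * r : ℕ) : ℤ)) by push_cast; ring, Pi.single_neg,
        tau_zero_neg]
  calc tau 3 p 0 z ^ 2 ≤ tau 3 p 0 (Pi.single i (2 * z i)) := hmain
    _ = tau 3 p 0 (Pi.single 0 (2 * z i)) := tau_single_eq p i _
    _ = tau 3 p 0 (((2 * r : ℕ) : ℤ) • Pi.single (0 : Fin 3) (1 : ℤ)) := by
        rw [hkey, zsmul_single_eq]

/-! ### (D) Arithmetic: the explicit rate bound is eventually small -/

/-- **(D)** `log (72 (2r+1)⁶) / (2r) < ε` for some `r ≥ 1`: for `r ≥ 1`,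
`log (72 (2r+1)⁶) ≤ log 72 + 6 log 3 + 6 log r`, and `C/r → 0`, `log r / r → 0`. -/
theorem exists_rate_bound_lt {ε : ℝ} (hε : 0 < ε) :
    ∃ r : ℕ, 1 ≤ r ∧ Real.log (72 * (2 * (r : ℝ) + 1) ^ 6) / (2 * r) < ε := by
  set C : ℝ := Real.log 72 + 6 * Real.log 3 with hC
  have h1 : Tendsto (fun r : ℕ => C / 2 / (r : ℝ)) atTop (𝓝 0) :=
    tendsto_const_div_atTop_nhds_zero_nat (C / 2)
  have h2 : Tendsto (fun r : ℕ => Real.log (r : ℝ) / (r : ℝ)) atTop (𝓝 0) := by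
    have := Real.isLittleO_log_id_atTop.tendsto_div_nhds_zero.comp tendsto_natCast_atTop_atTop
    simpa [Function.comp_def] using this
  have hG : Tendsto (fun r : ℕ => C / 2 / (r : ℝ) + 3 * (Real.log (r : ℝ) / (r : ℝ)))
      atTop (𝓝 0) := by
    have := h1.add (h2.const_mul 3)
    rw [mul_zero, add_zero] at this
    exact this
  obtain ⟨r, hr, hr1⟩ := ((hG.eventually (gt_mem_nhds hε)).and (eventually_ge_atTop 1)).exists
  refine ⟨r, hr1, lt_of_le_of_lt ?_ hr⟩
  have hr0 : (0 : ℝ) < r := by exact_mod_cast hr1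
  have hr0' : (r : ℝ) ≠ 0 := hr0.ne'
  have hlog : Real.log (72 * (2 * (r : ℝ) + 1) ^ 6) ≤ C + 6 * Real.log r := by
    rw [Real.log_mul (by norm_num) (by positivity), Real.log_pow]
    have h3 : Real.log (2 * (r : ℝ) + 1) ≤ Real.log 3 + Real.log r := by
      rw [← Real.log_mul (by norm_num) hr0']
      have : (1 : ℝ) ≤ r := by exact_mod_cast hr1
      exact Real.log_le_log (by positivity) (by linarith)
    rw [hC]
    push_cast
    linarith
  calc Real.log (72 * (2 * (r : ℝ) + 1) ^ 6) / (2 * r) ≤ (C + 6 * Real.log r) / (2 * r) := by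
        gcongr
    _ = C / 2 / r + 3 * (Real.log r / r) := by
        field_simp
        ring

end StubMassVanishes

open StubMassVanishes in
/-- **`stub_massVanishes`** (registered stub of line `registered`, crux stmt-CriticalPhenomena-11550):
the axial mass of bond percolation on `ℤ³` vanishes as `p ↑ p_c` — for every `ε > 0` there is
`p₀ < p_c(ℤ³)` such that for all `p ∈ (p₀, p_c)` every `m` with `-log τ_p(0, n e₀)/n → m` has
`m < ε` (Grimmett 1999, Thm. (6.14), upper-bound half). Assembly of (A)–(D): choose `r` by
`exists_rate_bound_lt`, `z ∈ ∂Λ_r` by `exists_sphere_tau_ge`, so `τ_{p_c}(0, 2r e₀) ≥ δ²`,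
`δ = 1/(6(2r+1)³)` (`sq_le_tau_axis`); lower semicontinuity at `p_c` yields `p₀ < p_c` with
`τ_p(0, 2r e₀) > δ²/2` on `(p₀, p_c]`, and `rate_le_quotient` at `n = 2r` gives
`m ≤ -log τ_p(0, 2r e₀)/(2r) < log(72 (2r+1)⁶)/(2r) < ε`. -/
theorem stub_massVanishes :
    ∀ ε : ℝ, 0 < ε → ∃ p₀ : unitInterval, p₀ < criticalProbI 3 ∧
      ∀ p : unitInterval, p₀ < p → p < criticalProbI 3 →
        ∀ m : ℝ, HasInvCorrLength (tau 3 p 0) m → m < ε := by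
  intro ε hε
  obtain ⟨r, hr1, hrε⟩ := exists_rate_bound_lt hε
  obtain ⟨z, hz, hδ⟩ := exists_sphere_tau_ge r
  set v : Site 3 := (((2 * r : ℕ) : ℤ) • Pi.single (0 : Fin 3) (1 : ℤ)) with hv
  set δ : ℝ := 1 / (6 * (2 * (r : ℝ) + 1) ^ 3) with hδdef
  have hδpos : 0 < δ := by positivity
  have hη : δ ^ 2 ≤ tau 3 (criticalProbI 3) 0 v :=
    (pow_le_pow_left₀ hδpos.le hδ 2).trans (sq_le_tau_axis (criticalProbI 3) hz)
  -- lower semicontinuity of `p ↦ τ_p(0, v)` at `p_c`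
  have hlsc : ∀ᶠ q in 𝓝 (criticalProbI 3), tau 3 (criticalProbI 3) 0 v / 2 <
      (bondPercolation (zdGraph 3) q).real (openConn 0 v) :=
    (lowerSemicontinuousAt_iff.1 ((lowerSemicontinuous_real_openConn (zdGraph 3) (0 : Site 3)
      v).lowerSemicontinuousAt (criticalProbI 3))) _
      (show tau 3 (criticalProbI 3) 0 v / 2 < tau 3 (criticalProbI 3) 0 v by
        have : 0 < tau 3 (criticalProbI 3) 0 v := lt_of_lt_of_le (by positivity) hη
        linarith)
  have hpc0 : (0 : unitInterval) < criticalProbI 3 := by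
    rw [← Subtype.coe_lt_coe, coe_criticalProbI]
    exact_mod_cast criticalProb_zd_pos 3 (by norm_num)
  obtain ⟨p₀, hp₀, hsub⟩ := exists_Ioc_subset_of_mem_nhds hlsc ⟨0, hpc0⟩
  refine ⟨p₀, hp₀, fun p hp₀p hppc m hm => ?_⟩
  have hp : 0 < (p : ℝ) := lt_of_le_of_lt (unitInterval.nonneg p₀) (Subtype.coe_lt_coe.2 hp₀p)
  have hτp : tau 3 (criticalProbI 3) 0 v / 2 < tau 3 p 0 v := hsub ⟨hp₀p, hppc.le⟩
  have hn1 : 1 ≤ 2 * r := by omega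
  have hA : m ≤ -Real.log (tau 3 p 0 v) / ((2 * r : ℕ) : ℝ) := rate_le_quotient hp hm hn1
  have hlt : δ ^ 2 / 2 < tau 3 p 0 v := by linarith
  have h72 : Real.log (72 * (2 * (r : ℝ) + 1) ^ 6) = -Real.log (δ ^ 2 / 2) := by
    rw [← Real.log_inv]
    congr 1
    rw [hδdef]
    field_simp
    ring
  have hlogle : -Real.log (tau 3 p 0 v) < Real.log (72 * (2 * (r : ℝ) + 1) ^ 6) := by
    rw [h72, neg_lt_neg_iff]
    exact Real.log_lt_log (by positivity) hlt
  have hnR : ((2 * r : ℕ) : ℝ) = 2 * (r : ℝ) := by push_cast; ring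
  calc m ≤ -Real.log (tau 3 p 0 v) / ((2 * r : ℕ) : ℝ) := hA
    _ < Real.log (72 * (2 * (r : ℝ) + 1) ^ 6) / (2 * r) := by
        rw [hnR]
        exact div_lt_div_of_pos_right hlogle (by positivity)
    _ < ε := hrε

end Summit.CriticalPhenomena.PercolationContinuityZ3.Theorems.BlockCrossover

end
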